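import Summits.Ventures.CertifiedArithmetic.Expansions.CompressStaircaseFixedPoint
import Mathlib.Tactic.Linarith
import Mathlib.Tactic.Positivity
import Mathlib.Tactic.Ring
import Mathlib.Tactic.NormNum

/-!
# COMPRESS off the ties, I: a tie-free downward sweep delivers a strict stair (new work)

New work of the certified-arithmetic venture (ENGINES group: shared numerical engines serving
client cells; rigour lives in the verifiers; every published number belongs to a client cell's
ledger, not to the engines group).  Line: the structure of Shewchuk's COMPRESS
[Shewchuk1997, §2.7 p. 332, Theorem 23], in the setting of the tree's `Shewchuk1997.Compress`
(radix 2, `p`-bit floats with gradual underflow `emin`, any round-to-nearest `fl`, expansions listed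
smallest component first).  NOT a published theorem: Shewchuk proves Theorem 23 (nonoverlapping /
nonadjacent output, `hₙ` within `ulp(hₙ)` of the sum) and says nothing about iterating COMPRESS.

COMPRESS is not idempotent in general (`CompressNotIdempotent.lean`, `CompressThreePasses.lean`:
inputs needing two and three passes; longer inputs need more).  This file and its sequel
`CompressTieFreeIdempotent.lean` isolate the mechanism: every extra pass is caused by a ROUNDING
TIE.  Call a rounding `fl t` TIE-FREE when `|t − fl t| < ½ulp(t)` (`TieFree`; for round-to-nearest
`≤` always holds [BoldoEtAl2023, §2.1], with equality exactly when `t` is midway between two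
adjacent floats), and say that COMPRESS RUNS TIE-FREE on `e` (`CompressTieFree` = `DownTieFree` of
Lines 1–9 and `UpTieFree` of Lines 10–16, defined by the recursions of `compressDown` /
`compressUp`) when the sum `Q + eᵢ`, resp. `gᵢ + Q`, of every FAST-TWO-SUM performed is rounded
without a tie (the other two operations of FAST-TWO-SUM are exact, `fastTwoSum_exact`, hence
trivially tie-free, `tieFree_of_isFloat`).

MAIN RESULT HERE, `compressDown_isChain_of_tieFree`: from a float carry `Q` above nonoverlapping
float components (`p ≥ 2`), a downward sweep that runs tie-free delivers a STRICT STAIR —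
consecutive outputs `a` (above) and `b` (below) satisfy `b ≠ 0`, `2|b| ≤ ulp(a)` and
`2|b| ≤ ulp(a + b)` (`SAbsorbs`; Theorem 23's sweep only gives `|b| ≤ ulp(a)`, `DownOut.chain`, with
equality attained at ties).  Mechanism: a tie-free roundoff `q` of `Q + eᵢ` is a multiple of the
common quantum `2^s` lying STRICTLY inside `½ulp(Q + eᵢ)`, so `|q| + 2^s ≤ ½ulp(Q + eᵢ)` and
everything still to come (`< 2^s` in total, Lemma 15) keeps the next output within the half-ulp;
the binade bookkeeping is the passenger lemma `ulp_le_ulp_fl_add` (a rounded value plus a small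
term on the side of the rounded-away part never lands in a lower binade), and `y ≠ 0` because a
nonzero multiple of `2^emin` rounds to at least `2^emin` in magnitude.  The sequel shows that on a
strict stair a tie-free upward sweep changes nothing and that the output is then fixed by COMPRESS
under every round-to-nearest.  Toolkit lemmas (`ulp_le_two_zpow_of_abs_lt_two_zpow`,
`exists_eq_int_mul_ulp_add`, `two_zpow_add_le_abs_of_lt`) are routine grid facts
[BoldoEtAl2023, §2.1 Def. 2.4].

EVIDENCE BEFORE THE PROOF (integer model of COMPRESS, not part of the formal content): in 48 788
tie-free runs of the model (`p = 2…5`, up to 9 components, random and exhaustive small ranges) the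
downward output satisfied the strict stair in every case; with ties allowed `2|b| = ulp(a)` occurs
(e.g. `p = 4`, `e = ⟨15, 16, 320⟩`, `g = ⟨−1, 32, 320⟩`, the example of `Shewchuk1997.Compress`).
-/

namespace Summit.Ventures.CertifiedArithmetic.Expansions

open Literature.ComputerArithmetic.JeannerodRump2018
open Literature.ComputerArithmetic.BoldoJeannerodMelquiondMuller2023 hiding twoSum twoSum_fst
open Literature.ComputerArithmetic.JoldesMullerPopescu2017 (abs_fl_le_of_abs_le)
open Literature.ComputerArithmetic.Shewchuk1997

variable {p : ℕ} {emin : ℤ} {fl : ℚ → ℚ}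

/-! ### Ties -/

/-- `fl` rounds `t` WITHOUT A TIE: `|t − fl t| < ½ulp(t)` (for a round-to-nearest the non-strict
inequality always holds, `abs_sub_fl_le_half_ulp`, BoldoEtAl2023 §2.1). -/
def TieFree (p : ℕ) (emin : ℤ) (fl : ℚ → ℚ) (t : ℚ) : Prop := |t - fl t| < ulp p emin t / 2

/-- An exact operation is tie-free. [cite: BoldoEtAl2023, §2.1] -/
theorem tieFree_of_isFloat (hfl : IsRoundNearest p emin fl) {t : ℚ} (ht : IsFloat p emin t) :
    TieFree p emin fl t := by
  rw [TieFree, fl_eq_self hfl ht, sub_self, abs_zero]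
  exact half_pos (ulp_pos (p := p) (emin := emin) t)

/-- The downward sweep (Lines 1–9) from carry `Q` over `xs` (largest first) RUNS TIE-FREE: the sum
`Q + x` of each FAST-TWO-SUM(Q, x) it performs is rounded without a tie (same recursion as
`compressDown`; Shewchuk1997 §2.7 p. 332, COMPRESS Lines 1–9). -/
def DownTieFree (p : ℕ) (emin : ℤ) (fl : ℚ → ℚ) : ℚ → List ℚ → Prop
  | _, [] => True
  | Q, x :: xs => TieFree p emin fl (Q + x) ∧ DownTieFree p emin fl
      (if (fastTwoSum fl Q x).2 = 0 then (fastTwoSum fl Q x).1 else (fastTwoSum fl Q x).2) xs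

/-- The upward sweep (Lines 10–16) from carry `Q` over `gs` (smallest first) RUNS TIE-FREE: the sum
`g + Q` of each FAST-TWO-SUM(g, Q) it performs is rounded without a tie (same recursion as
`compressUp`; Shewchuk1997 §2.7 p. 332, COMPRESS Lines 10–16). -/
def UpTieFree (p : ℕ) (emin : ℤ) (fl : ℚ → ℚ) : ℚ → List ℚ → Prop
  | _, [] => True
  | Q, g :: gs => TieFree p emin fl (g + Q) ∧ UpTieFree p emin fl (fastTwoSum fl g Q).1 gs

/-- COMPRESS RUNS TIE-FREE on `e` (smallest component first): both sweeps do (Shewchuk1997 §2.7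
p. 332, COMPRESS). -/
def CompressTieFree (p : ℕ) (emin : ℤ) (fl : ℚ → ℚ) (e : List ℚ) : Prop :=
  match e.reverse with
  | [] => True
  | em :: rest => DownTieFree p emin fl em rest ∧
      UpTieFree p emin fl (compressDown fl em rest).2 (compressDown fl em rest).1.reverse

/-! ### Toolkit: binades and grids -/

/-- `|t| < 2^(u+p)` with `u ≥ emin` ⟹ `ulp(t) ≤ 2^u`. [cite: BoldoEtAl2023, §2.1 Def. 2.4] -/
theorem ulp_le_two_zpow_of_abs_lt_two_zpow {u : ℤ} (hu : emin ≤ u) {t : ℚ}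
    (ht : |t| < (2 : ℚ) ^ (u + p)) : ulp p emin t ≤ (2 : ℚ) ^ u := by
  by_cases ht0 : t = 0
  · rw [ht0, ulp_zero]; exact zpow_le_zpow_right₀ (by norm_num) hu
  · rw [ulp_of_ne_zero ht0]
    apply zpow_le_zpow_right₀ (by norm_num : (1 : ℚ) ≤ 2)
    have hlog : Int.log 2 |t| < u + p :=
      (Int.lt_zpow_iff_log_lt (b := 2) (by norm_num) (abs_pos.mpr ht0)).mp (by exact_mod_cast ht)
    exact max_le hu (by omega)

/-- A float `g` is an integer multiple of `ulp(g + a)` whenever `2|a| ≤ ulp(g)` (the sum stays below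
`2^(e+p)` for any representation `g = M·2^e`). [cite: BoldoEtAl2023, §2.1 Def. 2.4] -/
theorem exists_eq_int_mul_ulp_add {g a : ℚ} (hg : IsFloat p emin g)
    (ha : 2 * |a| ≤ ulp p emin g) : ∃ K : ℤ, g = (K : ℚ) * ulp p emin (g + a) := by
  obtain ⟨M, e, hM, he, rfl⟩ := hg
  have h2 : (0 : ℚ) < 2 := by norm_num
  have h2e : (0 : ℚ) < (2 : ℚ) ^ e := zpow_pos h2 e
  have hMq : |(M : ℚ)| ≤ (2 : ℚ) ^ (p : ℤ) - 1 := by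
    have : |M| ≤ 2 ^ p - 1 := by omega
    rw [zpow_natCast, ← Int.cast_abs]; exact_mod_cast this
  have hg_abs : |(M : ℚ) * 2 ^ e| ≤ ((2 : ℚ) ^ (p : ℤ) - 1) * 2 ^ e := by
    rw [abs_mul, abs_of_pos h2e]; exact mul_le_mul_of_nonneg_right hMq h2e.le
  have hpe : (2 : ℚ) ^ (p : ℤ) * 2 ^ e = 2 ^ (e + p) := by
    rw [zpow_add₀ (ne_of_gt h2), mul_comm]
  have hug : ulp p emin ((M : ℚ) * 2 ^ e) ≤ 2 ^ e := by
    apply ulp_le_two_zpow_of_abs_lt_two_zpow he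
    rw [← hpe]; nlinarith
  have huga : ulp p emin ((M : ℚ) * 2 ^ e + a) ≤ 2 ^ e := by
    apply ulp_le_two_zpow_of_abs_lt_two_zpow he
    rw [← hpe]
    calc |(M : ℚ) * 2 ^ e + a| ≤ |(M : ℚ) * 2 ^ e| + |a| := abs_add_le _ _
      _ ≤ ((2 : ℚ) ^ (p : ℤ) - 1) * 2 ^ e + 2 ^ e / 2 := by linarith
      _ < (2 : ℚ) ^ (p : ℤ) * 2 ^ e := by linarith
  obtain ⟨w, -, hw⟩ := exists_ulp_eq_two_zpow (p := p) (emin := emin) ((M : ℚ) * 2 ^ e + a)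
  rw [hw] at huga ⊢
  have hwe : w ≤ e := (zpow_le_zpow_iff_right₀ (by norm_num : (1 : ℚ) < 2)).mp huga
  obtain ⟨d, hd⟩ := Int.eq_ofNat_of_zero_le (sub_nonneg.mpr hwe)
  refine ⟨M * 2 ^ d, ?_⟩
  push_cast
  rw [mul_assoc, ← zpow_natCast, ← zpow_add₀ (ne_of_gt h2), show ((d : ℕ) : ℤ) + w = e by omega]

/-- FLOAT SPACING ABOVE A POWER OF TWO: a float beyond `2^E` in magnitude is at least
`2^E + 2^(E−p+1)`. [cite: BoldoEtAl2023, §2.1 Def. 2.4] -/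
theorem two_zpow_add_le_abs_of_lt (hp : 1 ≤ p) {c : ℚ} (hc : IsFloat p emin c) {E : ℤ}
    (hE : (2 : ℚ) ^ E < |c|) : (2 : ℚ) ^ E + (2 : ℚ) ^ (E - p + 1) ≤ |c| := by
  obtain ⟨K, hK⟩ := exists_eq_int_mul_two_zpow_of_isFloat hc hE.le
  have h2 : (0 : ℚ) < 2 := by norm_num
  have hw : (0 : ℚ) < (2 : ℚ) ^ (E - p + 1) := zpow_pos h2 _
  have hsplit : (2 : ℚ) ^ E = ((2 ^ (p - 1) : ℤ) : ℚ) * (2 : ℚ) ^ (E - p + 1) := by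
    push_cast
    rw [← zpow_natCast, ← zpow_add₀ (ne_of_gt h2)]
    congr 1; omega
  have habs : |c| = |(K : ℚ)| * (2 : ℚ) ^ (E - p + 1) := by rw [hK, abs_mul, abs_of_pos hw]
  rw [habs, hsplit] at hE ⊢
  have hK1 : ((2 ^ (p - 1) : ℤ) : ℚ) < |(K : ℚ)| := lt_of_mul_lt_mul_right hE hw.le
  rw [← Int.cast_abs] at hK1 ⊢
  have hK2 : (2 ^ (p - 1) : ℤ) + 1 ≤ |K| := Int.add_one_le_iff.mpr (by exact_mod_cast hK1)
  have hK3 : (((2 ^ (p - 1) : ℤ) : ℚ) + 1) ≤ ((|K| : ℤ) : ℚ) := by exact_mod_cast hK2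
  calc ((2 ^ (p - 1) : ℤ) : ℚ) * (2 : ℚ) ^ (E - p + 1) + (2 : ℚ) ^ (E - p + 1)
        = (((2 ^ (p - 1) : ℤ) : ℚ) + 1) * (2 : ℚ) ^ (E - p + 1) := by ring
    _ ≤ ((|K| : ℤ) : ℚ) * (2 : ℚ) ^ (E - p + 1) := mul_le_mul_of_nonneg_right hK3 hw.le

/-- A ROUNDED VALUE WITH A PASSENGER NEVER LANDS IN A LOWER BINADE: if `d` is zero, or points from
`fl t` to the side of `t ≠ fl t`, and `2|d| ≤ ulp(t)`, then `ulp(t) ≤ ulp(fl t + d)` (for `d = 0`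
this is [BoldoEtAl2023, Property 2.7]: `ulp(t) ≤ ulp(RN t)`). [cite: BoldoEtAl2023, §2.6 Property 2.7] -/
theorem ulp_le_ulp_fl_add (hp : 1 ≤ p) (hfl : IsRoundNearest p emin fl) {t d : ℚ}
    (hd : 2 * |d| ≤ ulp p emin t) (hsd : d = 0 ∨ 0 < d * (t - fl t)) :
    ulp p emin t ≤ ulp p emin (fl t + d) := by
  rcases hsd with rfl | hsd
  · rw [add_zero]; exact ulp_le_ulp_fl hp hfl t
  have ht0 : t ≠ 0 := by
    rintro rfl
    rw [fl_zero hfl, sub_self, mul_zero] at hsd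
    exact lt_irrefl _ hsd
  rcases le_or_gt (Int.log 2 |t| - p + 1) emin with hle | hgt
  · rw [ulp_of_ne_zero ht0, max_eq_left hle]; exact two_zpow_emin_le_ulp _
  set E := Int.log 2 |t| with hEdef
  have h2 : (0 : ℚ) < 2 := by norm_num
  have hEpos : (0 : ℚ) < (2 : ℚ) ^ E := zpow_pos h2 E
  have hut : ulp p emin t = (2 : ℚ) ^ (E - p + 1) := by
    rw [ulp_of_ne_zero ht0, max_eq_right hgt.le]
  have hpowF : IsFloat p emin ((2 : ℚ) ^ E) := by
    have := isFloat_two_pow_mul_zpow (p := p) (emin := emin) hp (k := E - p) (by omega)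
    rwa [← zpow_natCast, ← zpow_add₀ (by norm_num : (2 : ℚ) ≠ 0),
      show (p : ℤ) + (E - p) = E by omega] at this
  have hEt : (2 : ℚ) ^ E ≤ |t| := zpow_log_le_abs ht0
  have hEfl : (2 : ℚ) ^ E ≤ |fl t| := by
    have := abs_le_abs_fl hfl hpowF (show |(2 : ℚ) ^ E| ≤ |t| by rwa [abs_of_pos hEpos])
    rwa [abs_of_pos hEpos] at this
  have hw2 : (2 : ℚ) ^ (E - p + 1) = 2 * (2 : ℚ) ^ (E - (p : ℤ)) := by
    rw [zpow_add_one₀ (ne_of_gt h2)]; ring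
  have hdE : |d| ≤ (2 : ℚ) ^ (E - (p : ℤ)) := by rw [hut, hw2] at hd; linarith
  have hwpos : (0 : ℚ) < (2 : ℚ) ^ (E - (p : ℤ)) := zpow_pos h2 _
  rw [hut]
  apply two_zpow_le_ulp_of_le_abs
  rcases le_or_gt 0 (fl t * d) with hsame | hopp
  · -- same sign: the passenger moves away from zero
    rw [(abs_add_eq_add_abs_iff _ _).mpr (mul_nonneg_iff.mp hsame)]
    linarith [abs_nonneg d]
  · rcases mul_neg_iff.mp hopp with ⟨hflpos, hdneg⟩ | ⟨hflneg, hdpos⟩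
    · -- `fl t > 0`, `d < 0`: then `t < fl t`, so `fl t ≥ 2^E + 2^(E−p+1)`
      have hq : t - fl t < 0 := by
        by_contra hq; exact absurd hsd (not_lt.mpr (mul_nonpos_of_nonpos_of_nonneg hdneg.le (not_lt.mp hq)))
      have htpos : 0 < t := by
        by_contra h
        have := fl_le_of_le hfl (isFloat_zero p emin) (not_lt.mp h)
        linarith
      rw [abs_of_pos htpos] at hEt
      have hgrid := two_zpow_add_le_abs_of_lt hp (hfl t).1 (E := E)
        (by rw [abs_of_pos hflpos]; linarith)
      rw [abs_of_pos hflpos] at hgrid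
      rw [abs_of_neg hdneg] at hdE
      rw [abs_of_pos (by linarith)]
      linarith
    · -- `fl t < 0`, `d > 0`: mirror image
      have hq : 0 < t - fl t := by
        by_contra hq; exact absurd hsd (not_lt.mpr (mul_nonpos_of_nonneg_of_nonpos hdpos.le (not_lt.mp hq)))
      have htneg : t < 0 := by
        by_contra h
        have := le_fl_of_le hfl (isFloat_zero p emin) (not_lt.mp h)
        linarith
      rw [abs_of_neg htneg] at hEt
      have hgrid := two_zpow_add_le_abs_of_lt hp (hfl t).1 (E := E)
        (by rw [abs_of_neg hflneg]; linarith)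
      rw [abs_of_neg hflneg] at hgrid
      rw [abs_of_pos hdpos] at hdE
      rw [abs_of_neg (by linarith)]
      linarith

/-! ### Lines 1–9 off the ties: the strict stair -/

/-- The STRICT STAIR relation between an emitted component `a` and the next output `b` below it:
`b ≠ 0`, `2|b| ≤ ulp(a)` and `2|b| ≤ ulp(a + b)` (a strict form of the chain condition in the proof
of Shewchuk1997 Thm 23, p. 333). -/
def SAbsorbs (p : ℕ) (emin : ℤ) (a b : ℚ) : Prop :=
  b ≠ 0 ∧ 2 * |b| ≤ ulp p emin a ∧ 2 * |b| ≤ ulp p emin (a + b)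

/-- **Lines 1–9 off the ties.**  From a float carry `Q` above nonoverlapping float components `xs`
(largest first, each 1-below `Q`), a downward sweep that runs tie-free delivers a strict stair:
`(g's ++ [g_bottom]).IsChain SAbsorbs`. [cite: Shewchuk1997, Thm 23 p. 333 (proof)] -/
theorem compressDown_isChain_of_tieFree (hp : 2 ≤ p) (hfl : IsRoundNearest p emin fl) :
    ∀ (xs : List ℚ) (Q : ℚ), IsFloat p emin Q → (∀ y ∈ xs, IsFloat p emin y) →
      IsExpansion 1 xs.reverse → (∀ y ∈ xs, Below 1 y Q) → DownTieFree p emin fl Q xs →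
      ((compressDown fl Q xs).1 ++ [(compressDown fl Q xs).2]).IsChain (SAbsorbs p emin) := by
  have hp1 : 1 ≤ p := le_trans (by norm_num) hp
  intro xs
  induction xs with
  | nil => intro Q _ _ _ _ _; simp
  | cons x xs ih =>
    intro Q hQ hF hexp hbel htf
    have hx : IsFloat p emin x := hF x (by simp)
    have hxsF : ∀ y ∈ xs, IsFloat p emin y := fun y hy => hF y (List.mem_cons_of_mem _ hy)
    rw [List.reverse_cons] at hexp
    have hexp' : IsExpansion 1 xs.reverse := hexp.sublist (List.sublist_append_left _ _)
    have hbelx : ∀ y ∈ xs, Below 1 y x := fun y hy =>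
      (List.pairwise_append.mp hexp).2.2 y (List.mem_reverse.mpr hy) x (by simp)
    have hxQ : Below 1 x Q := hbel x (by simp)
    have hbel' : ∀ y ∈ xs, Below 1 y Q := fun y hy => hbel y (List.mem_cons_of_mem _ hy)
    by_cases hQ0 : Q = 0
    · -- FAST-TWO-SUM(0, x) = (x, 0): an exact step
      have hF0 : fastTwoSum fl Q x = (x, 0) := by rw [hQ0]; exact fastTwoSum_zero_left hfl hx
      have hq : (fastTwoSum fl Q x).2 = 0 := by rw [hF0]
      have htf' : DownTieFree p emin fl x xs := by simpa [hq, hF0] using htf.2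
      rw [compressDown_cons_of_eq_zero hq, hF0]
      exact ih x hx hxsF hexp' hbelx htf'
    · have hxQ' : |x| ≤ |Q| := (hxQ.abs_lt le_rfl hQ0).le
      obtain ⟨h1, -, h2, -⟩ := fastTwoSum_exact hp1 hfl hQ hx hxQ'
      have hF12 := isFloat_fastTwoSum hfl Q x
      by_cases hq : (fastTwoSum fl Q x).2 = 0
      · -- exact step: the carry becomes `Q + x`
        have htf' : DownTieFree p emin fl (fastTwoSum fl Q x).1 xs := by simpa [hq] using htf.2
        rw [compressDown_cons_of_eq_zero hq]
        generalize hQn : (fastTwoSum fl Q x).1 = Qn at *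
        have hQnval : Qn = Q + x := by
          rw [h1]; rw [hq] at h2; linarith
        have hbelQn : ∀ y ∈ xs, Below 1 y Qn := by
          intro y hy
          obtain ⟨s, -, hsQ, hsx, hys⟩ := exists_grid_below_pair hQ hx (hbel' y hy) (hbelx y hy)
          exact ⟨s, by rw [hQnval]; exact hsQ.add hsx, by rwa [one_mul]⟩
        exact ih Qn hF12.1 hxsF hexp' hbelQn htf'
      · -- emitting step: `Qn` is emitted, the carry becomes the tie-free roundoff `q`
        have htfx : TieFree p emin fl (Q + x) := htf.1
        have htf' : DownTieFree p emin fl (fastTwoSum fl Q x).2 xs := by simpa [hq] using htf.2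
        rw [compressDown_cons_of_ne_zero hq]
        generalize hQn : (fastTwoSum fl Q x).1 = Qn at *
        generalize hqn : (fastTwoSum fl Q x).2 = q at *
        have hbelq : ∀ y ∈ xs, Below 1 y q := by
          intro y hy
          obtain ⟨s, hs, hsQ, hsx, hys⟩ := exists_grid_below_pair hQ hx (hbel' y hy) (hbelx y hy)
          have hst : OnGrid s (Q + x) := hsQ.add hsx
          exact ⟨s, by rw [h2]; exact hst.sub (hst.fl_of hp1 hfl hs), by rwa [one_mul]⟩
        have out := compressDown_spec hp hfl xs q hF12.2 hxsF hexp' hbelq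
        have hih := ih q hF12.2 hxsF hexp' hbelq htf'
        -- a common quantum below `Q` and `x` and above all of `xs`
        obtain ⟨s, hs, hsQ, hsx, hall⟩ :=
          exists_grid_below_list hQ hx (fun y hy => ⟨hbel' y hy, hbelx y hy⟩)
        have hst : OnGrid s (Q + x) := hsQ.add hsx
        have hsq : OnGrid s q := by rw [h2]; exact hst.sub (hst.fl_of hp1 hfl hs)
        have h2s_le_q : (2 : ℚ) ^ s ≤ |q| := hsq.two_zpow_le_abs hq
        -- the tie-free margin: `|q| + 2^s ≤ ½ulp(Q + x)`
        obtain ⟨u, -, hut⟩ := exists_ulp_eq_two_zpow (p := p) (emin := emin) (Q + x)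
        have hsplit : (2 : ℚ) ^ u / 2 = (2 : ℚ) ^ (u - 1) := by
          rw [show (2 : ℚ) ^ u = (2 : ℚ) ^ (u - 1) * 2 by
            rw [← zpow_add_one₀ (by norm_num : (2 : ℚ) ≠ 0), sub_add_cancel]]
          ring
        have hq_lt : |q| < (2 : ℚ) ^ (u - 1) := by
          rw [← hsplit, ← hut, h2]; exact htfx
        have hsu : s ≤ u - 1 :=
          ((zpow_lt_zpow_iff_right₀ (by norm_num : (1 : ℚ) < 2)).mp (h2s_le_q.trans_lt hq_lt)).le
        have hmargin : |q| + (2 : ℚ) ^ s ≤ (2 : ℚ) ^ (u - 1) :=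
          hsq.abs.add_two_zpow_le (OnGrid.two_zpow hsu) hq_lt
        have hhalfF : IsFloat p emin ((2 : ℚ) ^ (u - 1)) := by
          have := isFloat_of_int_mul (p := p) (emin := emin) 1 (u - 1)
            (by rw [abs_one]; exact_mod_cast Nat.one_lt_two_pow (by omega : p ≠ 0)) (hs.trans hsu)
          simpa using this
        -- the next output `y = fl(q + an initial segment of xs)`
        rw [List.cons_append, List.isChain_cons]
        refine ⟨?_, hih⟩
        intro y hy
        obtain ⟨pre, hpre, hhead⟩ := out.head
        rw [hhead] at hy
        have hyv : fl (q + pre.sum) = y := by simpa using hy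
        have hpreF : ∀ z ∈ pre, IsFloat p emin z := fun z hz => hxsF z (hpre.sublist.subset hz)
        have hpreE : IsExpansion 1 pre.reverse :=
          hexp'.sublist (List.reverse_sublist.mpr hpre.sublist)
        have hpre_sum : |pre.sum| < (2 : ℚ) ^ s :=
          abs_sum_lt_two_zpow_of_rev hpreF hpreE fun z hz => hall z (hpre.sublist.subset hz)
        have hw_le : |q + pre.sum| ≤ (2 : ℚ) ^ (u - 1) :=
          calc |q + pre.sum| ≤ |q| + |pre.sum| := abs_add_le _ _
            _ ≤ (2 : ℚ) ^ (u - 1) := by linarith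
        have hy_le : |y| ≤ (2 : ℚ) ^ (u - 1) := by
          rw [← hyv]; exact abs_fl_le_of_abs_le hfl hhalfF hw_le
        have hy2 : 2 * |y| ≤ ulp p emin (Q + x) := by rw [hut]; linarith [hsplit]
        -- `q + pre.sum` has the sign of `q`, hence so has `y` (weakly)
        have hsd : y = 0 ∨ 0 < y * (Q + x - fl (Q + x)) := by
          rcases eq_or_ne y 0 with hy0 | hy0
          · exact Or.inl hy0
          right
          rw [← h2]
          have hps := abs_lt.mp (hpre_sum.trans_le h2s_le_q)
          rcases lt_or_gt_of_ne hq with hqneg | hqpos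
          · rw [abs_of_neg hqneg] at hps
            have hyle : y ≤ 0 := by
              rw [← hyv]; exact fl_le_of_le hfl (isFloat_zero p emin) (by linarith [hps.2])
            exact mul_pos_of_neg_of_neg (lt_of_le_of_ne hyle hy0) hqneg
          · rw [abs_of_pos hqpos] at hps
            have hyge : 0 ≤ y := by
              rw [← hyv]; exact le_fl_of_le hfl (isFloat_zero p emin) (by linarith [hps.1])
            exact mul_pos (lt_of_le_of_ne hyge (Ne.symm hy0)) hqpos
        refine ⟨?_, ?_, ?_⟩
        · -- `y ≠ 0`: `q + pre.sum ≠ 0` is a multiple of `2^emin`, so `|y| ≥ 2^emin`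
          have hw0 : q + pre.sum ≠ 0 := by
            intro h0
            have hps := abs_lt.mp (hpre_sum.trans_le h2s_le_q)
            rcases lt_or_gt_of_ne hq with hqneg | hqpos
            · rw [abs_of_neg hqneg] at hps; linarith [hps.2]
            · rw [abs_of_pos hqpos] at hps; linarith [hps.1]
          have hwg : OnGrid emin (q + pre.sum) :=
            (OnGrid.of_isFloat hF12.2).add (OnGrid.listSum fun z hz => OnGrid.of_isFloat (hpreF z hz))
          have heminF : IsFloat p emin ((2 : ℚ) ^ emin) := by
            have := isFloat_of_int_mul (p := p) (emin := emin) 1 emin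
              (by rw [abs_one]; exact_mod_cast Nat.one_lt_two_pow (by omega : p ≠ 0)) le_rfl
            simpa using this
          have h2emin : (0 : ℚ) < (2 : ℚ) ^ emin := zpow_pos (by norm_num) _
          have hle : |(2 : ℚ) ^ emin| ≤ |q + pre.sum| := by
            rw [abs_of_pos h2emin]; exact hwg.two_zpow_le_abs hw0
          have := abs_le_abs_fl hfl heminF hle
          rw [hyv, abs_of_pos h2emin] at this
          intro hy0; rw [hy0, abs_zero] at this; linarith
        · -- `2|y| ≤ ulp(Qn)`: `ulp(Q + x) ≤ ulp(fl(Q + x))`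
          rw [h1]; exact hy2.trans (ulp_le_ulp_fl hp1 hfl _)
        · -- `2|y| ≤ ulp(Qn + y)`: the passenger lemma
          rw [h1]; exact hy2.trans (ulp_le_ulp_fl_add hp1 hfl hy2 hsd)

/-- The output relation: consecutive components `a` (smaller) and `b` are nonzero floats with
`|a| < ½ulp(b + a)` — so `b` absorbs `a` under EVERY round-to-nearest (BoldoEtAl2023 §2.6
Property 2.7). -/
def StrictlyAbsorbed (p : ℕ) (emin : ℤ) (a b : ℚ) : Prop :=
  a ≠ 0 ∧ IsFloat p emin a ∧ IsFloat p emin b ∧ |a| < ulp p emin (b + a) / 2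

end Summit.Ventures.CertifiedArithmetic.Expansions
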